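import Summits.BirchSwinnertonDyer.BirchSwinnertonDyer.Theorems.ErratumRoadFiveKernelFromPrintB
import Summits.BirchSwinnertonDyer.BirchSwinnertonDyer.Theorems.ErratumRoadFiveControlOfFacts
import HarnessLib

/-!
# Route `ErratumRoadFive` (rung K2): the RE-ORIENTED kernel «19061-body from print» WITHOUT the Jetchev–Skinner–Wan binder —
# `∀ W p, P2OpenInputOnTreeAt W p` from (VN_p), the core H3♭, the published bundle (19283), Wuthrich Prop. 21, REST‴ and the
# ¬(ram) input, the control identity supplied by the tree's kernel control theorem (cell `bsd-stepL`, seat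
# `bsd-stepL-imc-p1` g16; `--supports stmt-BirchSwinnertonDyer-19626`; Theses-free)

`Theorems/ErratumRoadFiveKernelFromPrintB.lean` (imc-p1 g9) proves
`KernelFromPrintB.openInputIMCBody_of_print_of_coreB_of_rest3_of_notRam` — the term behind `have h₁` of
`Theses.ErratumRoadFive.closes` — with a binder `h331 : thm331_anticyclotomicControl_mult` (K2 support item 19626, PUB)
used ONCE, to feed `X11b.P2ControlOnTreeAt W p` into imc-p1's one-sided tightness on the (ram) ∧ erratum locus. Here:

* `openInputIMCBody_of_print_of_coreB_of_rest3_of_notRam_of_p2Control` — the same theorem with that use ABSTRACTED as a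
  hypothesis `hC : ∀ W p, X11b.P2ControlOnTreeAt W p` (proof VERBATIM otherwise; every other binder byte-identical);
* **`openInputIMCBody_of_print_of_coreB_of_rest3_of_notRam_of_facts`** — `hC` DISCHARGED by
  `p2ControlOnTreeAt_forall_of_facts` (`Theorems/ErratumRoadFiveControlOfFacts.lean`: the tree's kernel control theorem
  `X11b.controlOnTreeAt_of_mult_of_rankOne_odd`) from conjuncts 2, 4, 13, 14 of the SAME published bundle `hF`
  (`rank_eq_analyticRank_of_analyticRank_le_one`, `exists_isNewformOf`, `poitouTate_selmerStructure_duality`,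
  `poitouTate_sha_tateDual`) — so the binder list is that of the original MINUS `h331`, nothing added;
* `…_of_facts_intCast` (REST‴'s integer-cast valuation clause) and `…_of_facts_at` (one pair).

Consequence (bookkeeping, nothing booked): the `have h₁` line of `closes` elaborates with `h331` deleted from the route's
deciding theorem; together with `P2.RoadFF.sigmaDataAtErratumDataB_of_sigmaLocal_of_prop323_of_facts` (the `have h3` line)
the support item 19626 `JSWAnticyclotomicControlMult` leaves the cone of `closes`.

HONEST FRAMING: theorems only (no definition, no named fact, no `sorry`); CONDITIONAL on (VN_p), the core H3♭ (OPEN at the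
(ram) ∧ erratum locus, claim-tagged), the published ∕ cited bundle, Wuthrich Prop. 21, REST‴ and the ¬(ram) input exactly
as the original; item 19626 is not closed; BSD is proved for no pair; no count moves (T7).

References: [Castella2018Erratum] (2.4), Thm. 2.3 (pp. 1, 4); [Castella2018Exceptional] Thms. 2.10–2.11;
[JetchevSkinnerWan2017] Thm. 3.3.1 with §3.5 (3.5.c) (arXiv:1512.06894 pp. 11, 15); [Wuthrich2014] Prop. 21 (p. 400);
[MilneADT2006] I Thm. 4.10, Thm. 2.8.
-/

set_option autoImplicit false
set_option linter.dupNamespace false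

noncomputable section
open scoped Classical Topology
open Filter WeierstrassCurve NumberField IsDedekindDomain Field PowerSeries
open Literature.NumberTheory.EllipticCurves Literature.NumberTheory.EllipticCurves.GreenbergSelmer
open Literature.NumberTheory.EllipticCurves.ModularForms
open Literature.NumberTheory.EllipticCurves.Rank1Residual
open Literature.NumberTheory.EllipticCurves.Rank1Residual.Typed
open Literature.NumberTheory.EllipticCurves.Wuthrich2014
open Literature.NumberTheory.EllipticCurves.Castella2018
open Literature.NumberTheory.EllipticCurves.JetchevSkinnerWan2017
open Literature.NumberTheory.GaloisRepresentations
open Literature.NumberTheory.GaloisCohomology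
open Summit.BirchSwinnertonDyer.Rank1Residual Summit.BirchSwinnertonDyer.Rank1Residual.X11b
open Summit.BirchSwinnertonDyer.Rank1Residual.X11b.AcSelmer
open Summit.BirchSwinnertonDyer.Rank1Residual.X11b.Halves

namespace Summit.BirchSwinnertonDyer.BirchSwinnertonDyer.Theorems.KernelFromPrintB

/-- **KERNEL FORM OF «19061 from print», RE-ORIENTED, with the control identity as a HYPOTHESIS `hC`** (every other binder
and the proof VERBATIM those of `openInputIMCBody_of_print_of_coreB_of_rest3_of_notRam`, whose `h331` fed only
`p2ControlOnTreeAt_of_thm331Mult`). CONDITIONAL; nothing booked. [claim: Castella2018Erratum, status: under-review]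
[cite: Castella2018Exceptional, Thms. 2.10–2.11 (arXiv:1507.04260 pp. 13–14)]
[cite: JetchevSkinnerWan2017, Thm. 3.3.1 with §3.5 (3.5.c) (arXiv:1512.06894 pp. 11, 15) (shape of hC)]
[cite: Wuthrich2014, Prop. 21 (p. 400)] [cite: Miller2011LMS, Def. 1.1] -/
theorem openInputIMCBody_of_print_of_coreB_of_rest3_of_notRam_of_p2Control
    (hVN : castella2018Exceptional_bdpValueContinuity_trivialChar)
    (h3 : ∀ (W : WeierstrassCurve ℚ) [W.IsElliptic] [W.IsGloballyMinimal] (p : ℕ) [Fact p.Prime],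
      P2.IMCDivIntCoreFrameAtErratumDataB W p)
    (hF : GrossZagier1986_thm_I_7_3 ∧ rank_eq_analyticRank_of_analyticRank_le_one ∧
      Skinner2016.thmC_padicValRat_bsd_rank_zero ∧ exists_isNewformOf ∧
      CaiShuTian2014.thm11_trivialChar ∧ friedbergHoffstein_exists_twist_ne_zero_ramifiedAt ∧
      mazur_not_dvd_maninConstant_of_odd ∧
      (∀ (N : ℕ) [NeZero N] (W : WeierstrassCurve ℚ) (K : Type) [Field K] [NumberField K],
        gross_zagier N W K) ∧
      (∀ (N : ℕ) [NeZero N] (W : WeierstrassCurve ℚ) (K : Type) [Field K] [NumberField K],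
        kolyvagin N W K) ∧
      (∀ (N : ℕ) [NeZero N] (W : WeierstrassCurve ℚ) (K : Type) [Field K] [NumberField K],
        Kolyvagin1990_padicValNat_card_sha_le N W K) ∧
      HoffsteinLuo1997_exists_twist_L_one_ne_zero ∧
      (∀ (K : Type) [Field K] [NumberField K], poitouTate_sum_localTatePairing_eq_zero K) ∧
      (∀ (K : Type) [Field K] [NumberField K], poitouTate_selmerStructure_duality K) ∧
      (∀ (K : Type) [Field K] [NumberField K], poitouTate_sha_tateDual K) ∧
      (∀ (K : Type) [Field K] [NumberField K] (v : HeightOneSpectrum (𝓞 K)),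
        localEulerPoincareCharacteristic (v.adicCompletion K)) ∧
      fieldCdLE_two_of_numberField)
    (hWu : sha_dvd_analyticSha)
    (hC : ∀ (W : WeierstrassCurve ℚ) [W.IsElliptic] [W.IsGloballyMinimal] (p : ℕ) [Fact p.Prime],
      P2ControlOnTreeAt W p)
    (hrest : ∀ (W : WeierstrassCurve ℚ) [W.IsElliptic] [W.IsGloballyMinimal] (p : ℕ) [Fact p.Prime],
      Ram W p →
      ¬ ((∃ (q : ℕ) (_ : Fact q.Prime), q ≠ 2 ∧ q ≠ p ∧ Mult W q ∧
            ¬ W.HasSplitMultiplicativeReductionAtPrime q ∧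
            ¬ p ∣ padicValInt q W.minimalDiscriminantInt) ∧
          (∀ P : (W.baseChange ℚ_[p]).toAffine.Point, p • P = 0 → P = 0)) →
      P2OpenInputOnTreeAt W p)
    (hOff : ∀ (W : WeierstrassCurve ℚ) [W.IsElliptic] [W.IsGloballyMinimal] (p : ℕ) [Fact p.Prime],
      ¬ Ram W p → P2OpenInputOnTreeAt W p) :
    ∀ (W : WeierstrassCurve ℚ) [W.IsElliptic] [W.IsGloballyMinimal] (p : ℕ) [Fact p.Prime],
      P2OpenInputOnTreeAt W p := by
  intro W _ _ p _
  obtain ⟨hGZ86, hGZK, hSk, hnf, hCST, hFH, hMaz, hGZ, hKo, -, -, hPTs, -, -, hEP, -⟩ := hF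
  by_cases hram : Ram W p
  · by_cases hw : (∃ (q : ℕ) (_ : Fact q.Prime), q ≠ 2 ∧ q ≠ p ∧ Mult W q ∧
        ¬ W.HasSplitMultiplicativeReductionAtPrime q ∧ ¬ p ∣ padicValInt q W.minimalDiscriminantInt) ∧
        (∀ P : (W.baseChange ℚ_[p]).toAffine.Point, p • P = 0 → P = 0)
    · obtain ⟨⟨q, hqF, hq2, hqp, hmq, hnsq, hvq⟩, htors⟩ := hw
      haveI := hqF
      refine p2OpenInputOnTreeAt_of_imp_surj W p fun hX hp5 _hs ↦ ?_
      have hr : W.analyticRank = 1 := hX.1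
      have hE : ErratumHypotheses W p := ⟨hp5, hX.2.2.1, hX.2.2.2, ⟨q, ‹_›, hqp, hmq, hnsq, hvq⟩, htors⟩
      -- (VN_p) at the erratum data of `(W, p)` from the published fact (binder bookkeeping)
      have hVNW : ∀ [NeZero (W.conductorNorm ℤ)] (q : ℕ) [Fact q.Prime] (K : Type) [Field K]
          [NumberField K] (Dt : ModularParametrizationData W (W.conductorNorm ℤ))
          (H : HeegnerDatum (W.conductorNorm ℤ) (NumberField.discr K)) (w₀ : InfinitePlace K)
          (P : (W.baseChange K).toAffine.Point), ErratumHypotheses W p → W.analyticRank = 1 →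
          q ≠ p → Mult W q → ¬ W.HasSplitMultiplicativeReductionAtPrime q →
          ¬ p ∣ padicValInt q W.minimalDiscriminantInt → IsErratumField W K q →
          Cas20Standing K p (W.conductorNorm ℤ / p) →
          WeierstrassCurve.Affine.Point.map w₀.embedding.toRatAlgHom P = heegnerPointComplex Dt H →
          ¬ (p : ℤ) ∣ Dt.c → ¬ IsOfFinAddOrder P →
          ∀ (κ : ZpExtension K p), κ.IsAnticyclotomic →
            ∀ (γ : Field.absoluteGaloisGroup K) [Fact (κ.IsTopGenerator γ)] (ι' : PadicAlgCl p ≃+* ℂ)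
              (e : K →+* ℚ_[p]),
              (∀ k : 𝓞 K, k ∈ (primeOfEmbeddingDatum p ι' w₀.embedding).asIdeal ↔ ‖e (k : K)‖ < 1) →
              ∃ (ΩK : ℂ) (Ωp : ℂ_[p]), ΩK ≠ 0 ∧ Ωp ≠ 0 ∧
                ∀ (φ : ℕ → HeckeCharacter K) (n : ℕ → ℕ)
                  (r : ℕ → FramedGaloisRep K (PadicAlgCl p) 1),
                  (∀ k, 0 < n k) → (∀ k (v : HeightOneSpectrum (𝓞 K)), (φ k).IsUnramifiedAt v) →
                  (∀ k, (φ k).HasInfinityType (fun _ ↦ (n k : ℤ)) (fun _ ↦ -(n k : ℤ))) →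
                  (∀ k, IsPAdicAvatarOf ι' (φ k) (r k)) → (∀ k, FactorsThroughZp κ (r k)) →
                  Tendsto (fun k ↦ avatarValueAt (r k) γ) atTop (𝓝 1) →
                  Tendsto (fun k ↦ ‖((ι'.symm (bdpInterpolationValue p Dt.f
                      (primeOfEmbeddingDatum p ι' w₀.embedding) (φ k) (n k) ΩK) : PadicAlgCl p) :
                      ℂ_[p]) * Ωp ^ (4 * n k)‖) atTop
                    (𝓝 (‖algebraMap ℚ_[p] ℂ_[p] (((1 : ℚ_[p]) - ((W.LFunction p : ℤ) : ℚ_[p]) *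
                      (p : ℚ_[p])⁻¹) * logOmega W p e P)‖ ^ 2)) := by
        intro _ q' _ K _ _ Dt H w₀ P hE' hr' hqp' hmq' hns' hvq' hK hCas hP hc hinf κ hκ γ hγ ι' e he
        have hpN : p ∣ W.conductorNorm ℤ := dvd_conductorNorm_of_mult hE'.2.1
        have hsign : ∀ (ℓ : ℕ) [Fact ℓ.Prime], ℓ ∣ W.conductorNorm ℤ → (ℓ : ℤ) ∣ NumberField.discr K →
            W.HasMultiplicativeReductionAtPrime ℓ ∧ ¬ W.HasSplitMultiplicativeReductionAtPrime ℓ := by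
          intro ℓ _ hℓN hℓD
          by_cases hℓq : ℓ = q'
          · subst hℓq
            exact ⟨hmq', hns'⟩
          · exact absurd hℓD
              (not_dvd_discr_of_splitsIn hK.1.1 Fact.out (hK.2.2.1 ℓ Fact.out hℓN hℓq))
        obtain ⟨ΩK, Ωp, u, hΩK, hΩp, hu, hcont⟩ :=
          hVN ι' W K (primeOfEmbeddingDatum p ι' w₀.embedding) κ γ Dt H w₀ e P hE'.1 rfl hE'.2.1 hK.1
            hCas.2.1 hCas.2.2.1 (hK.ncard_primesOver_eq_two Fact.out hpN hqp')
            (natCast_mem_primeOfEmbeddingDatum p ι' w₀.embedding)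
            (forall_mem_primeOfEmbeddingDatum_iff p ι' hK.1 w₀) (hK.forall_exists_absNorm_eq Fact.out)
            (fun ℓ _ hℓN hℓD ↦ hsign ℓ hℓN hℓD) hκ hγ.out hc hP he
        refine ⟨ΩK, Ωp, hΩK, hΩp, fun φ n r hn hunr hinf' hr'' hrκ hlim ↦ ?_⟩
        have h := (hcont φ n r hn hunr hinf' hr'' hrκ hlim).norm
        rw [norm_mul, hu, one_mul, norm_pow] at h
        rw [R1.logOmega_eq_padicLogOmega]
        exact h
      have hD : P2.IMCDivIntFrameAtErratumDataB W p :=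
        imcDivIntFrameAtErratumDataB_of_normContinuity_of_coreB hVNW (h3 W p)
      have hlow : Typed.MissingLowerBoundAt W p :=
        missingLowerBoundAt_of_erratumHypotheses_of_imcDivIntFrameAtErratumDataB W p hGZ86 hGZK hWu hnf
          hCST hFH hMaz hPTs hEP hD hE hq2 hqp hmq hnsq hvq hr
      exact openInputOnTreeAt_of_missingLowerBoundAt_of_ram W p hGZ hKo hSk hGZK
        (hasEntireLFunction_rat_of_exists_isNewformOf hnf)
        (hC W p) hram hlow
    · exact hrest W p hram hw
  · exact hOff W p hram

/-- **KERNEL FORM OF «19061 from print», RE-ORIENTED, WITHOUT the Jetchev–Skinner–Wan binder**: the binder list of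
`openInputIMCBody_of_print_of_coreB_of_rest3_of_notRam` MINUS `h331`; the control identity on the (ram) ∧ erratum locus is
`p2ControlOnTreeAt_forall_of_facts` fed by conjuncts 2, 4, 13, 14 of `hF`. Drop-in for the `have h₁` line of `closes`.
CONDITIONAL; nothing booked. [claim: Castella2018Erratum, status: under-review]
[cite: Castella2018Exceptional, Thms. 2.10–2.11 (arXiv:1507.04260 pp. 13–14)]
[cite: JetchevSkinnerWan2017, Thm. 3.3.1 with §3.5 (3.5.c) (arXiv:1512.06894 pp. 11, 15)]
[cite: Wuthrich2014, Prop. 21 (p. 400)] [cite: MilneADT2006, Ch. I, Thm. 4.10 and Thm. 2.8] -/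
theorem openInputIMCBody_of_print_of_coreB_of_rest3_of_notRam_of_facts
    (hVN : castella2018Exceptional_bdpValueContinuity_trivialChar)
    (h3 : ∀ (W : WeierstrassCurve ℚ) [W.IsElliptic] [W.IsGloballyMinimal] (p : ℕ) [Fact p.Prime],
      P2.IMCDivIntCoreFrameAtErratumDataB W p)
    (hF : GrossZagier1986_thm_I_7_3 ∧ rank_eq_analyticRank_of_analyticRank_le_one ∧
      Skinner2016.thmC_padicValRat_bsd_rank_zero ∧ exists_isNewformOf ∧
      CaiShuTian2014.thm11_trivialChar ∧ friedbergHoffstein_exists_twist_ne_zero_ramifiedAt ∧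
      mazur_not_dvd_maninConstant_of_odd ∧
      (∀ (N : ℕ) [NeZero N] (W : WeierstrassCurve ℚ) (K : Type) [Field K] [NumberField K],
        gross_zagier N W K) ∧
      (∀ (N : ℕ) [NeZero N] (W : WeierstrassCurve ℚ) (K : Type) [Field K] [NumberField K],
        kolyvagin N W K) ∧
      (∀ (N : ℕ) [NeZero N] (W : WeierstrassCurve ℚ) (K : Type) [Field K] [NumberField K],
        Kolyvagin1990_padicValNat_card_sha_le N W K) ∧
      HoffsteinLuo1997_exists_twist_L_one_ne_zero ∧
      (∀ (K : Type) [Field K] [NumberField K], poitouTate_sum_localTatePairing_eq_zero K) ∧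
      (∀ (K : Type) [Field K] [NumberField K], poitouTate_selmerStructure_duality K) ∧
      (∀ (K : Type) [Field K] [NumberField K], poitouTate_sha_tateDual K) ∧
      (∀ (K : Type) [Field K] [NumberField K] (v : HeightOneSpectrum (𝓞 K)),
        localEulerPoincareCharacteristic (v.adicCompletion K)) ∧
      fieldCdLE_two_of_numberField)
    (hWu : sha_dvd_analyticSha)
    (hrest : ∀ (W : WeierstrassCurve ℚ) [W.IsElliptic] [W.IsGloballyMinimal] (p : ℕ) [Fact p.Prime],
      Ram W p →
      ¬ ((∃ (q : ℕ) (_ : Fact q.Prime), q ≠ 2 ∧ q ≠ p ∧ Mult W q ∧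
            ¬ W.HasSplitMultiplicativeReductionAtPrime q ∧
            ¬ p ∣ padicValInt q W.minimalDiscriminantInt) ∧
          (∀ P : (W.baseChange ℚ_[p]).toAffine.Point, p • P = 0 → P = 0)) →
      P2OpenInputOnTreeAt W p)
    (hOff : ∀ (W : WeierstrassCurve ℚ) [W.IsElliptic] [W.IsGloballyMinimal] (p : ℕ) [Fact p.Prime],
      ¬ Ram W p → P2OpenInputOnTreeAt W p) :
    ∀ (W : WeierstrassCurve ℚ) [W.IsElliptic] [W.IsGloballyMinimal] (p : ℕ) [Fact p.Prime],
      P2OpenInputOnTreeAt W p := by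
  have hF' := hF
  obtain ⟨-, hGZK, -, hnf, -, -, -, -, -, -, -, -, hPT, hPT2, -, -⟩ := hF'
  exact openInputIMCBody_of_print_of_coreB_of_rest3_of_notRam_of_p2Control hVN h3 hF hWu
    (p2ControlOnTreeAt_forall_of_facts hGZK hnf hPT hPT2) hrest hOff


/-- **The same with REST‴'s integer-cast valuation clause** (the spelling of `RamNoErratumDataAtFive`), without the
Jetchev–Skinner–Wan binder. [folklore] -/
theorem openInputIMCBody_of_print_of_coreB_of_rest3_of_notRam_of_facts_intCast
    (hVN : castella2018Exceptional_bdpValueContinuity_trivialChar)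
    (h3 : ∀ (W : WeierstrassCurve ℚ) [W.IsElliptic] [W.IsGloballyMinimal] (p : ℕ) [Fact p.Prime],
      P2.IMCDivIntCoreFrameAtErratumDataB W p)
    (hF : GrossZagier1986_thm_I_7_3 ∧ rank_eq_analyticRank_of_analyticRank_le_one ∧
      Skinner2016.thmC_padicValRat_bsd_rank_zero ∧ exists_isNewformOf ∧
      CaiShuTian2014.thm11_trivialChar ∧ friedbergHoffstein_exists_twist_ne_zero_ramifiedAt ∧
      mazur_not_dvd_maninConstant_of_odd ∧
      (∀ (N : ℕ) [NeZero N] (W : WeierstrassCurve ℚ) (K : Type) [Field K] [NumberField K],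
        gross_zagier N W K) ∧
      (∀ (N : ℕ) [NeZero N] (W : WeierstrassCurve ℚ) (K : Type) [Field K] [NumberField K],
        kolyvagin N W K) ∧
      (∀ (N : ℕ) [NeZero N] (W : WeierstrassCurve ℚ) (K : Type) [Field K] [NumberField K],
        Kolyvagin1990_padicValNat_card_sha_le N W K) ∧
      HoffsteinLuo1997_exists_twist_L_one_ne_zero ∧
      (∀ (K : Type) [Field K] [NumberField K], poitouTate_sum_localTatePairing_eq_zero K) ∧
      (∀ (K : Type) [Field K] [NumberField K], poitouTate_selmerStructure_duality K) ∧
      (∀ (K : Type) [Field K] [NumberField K], poitouTate_sha_tateDual K) ∧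
      (∀ (K : Type) [Field K] [NumberField K] (v : HeightOneSpectrum (𝓞 K)),
        localEulerPoincareCharacteristic (v.adicCompletion K)) ∧
      fieldCdLE_two_of_numberField)
    (hWu : sha_dvd_analyticSha)
    (hrest : ∀ (W : WeierstrassCurve ℚ) [W.IsElliptic] [W.IsGloballyMinimal] (p : ℕ) [Fact p.Prime],
      Ram W p →
      ¬ ((∃ (q : ℕ) (_ : Fact q.Prime), q ≠ 2 ∧ q ≠ p ∧ Mult W q ∧
            ¬ W.HasSplitMultiplicativeReductionAtPrime q ∧
            ¬ (p : ℤ) ∣ (padicValInt q W.minimalDiscriminantInt : ℤ)) ∧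
          (∀ P : (W.baseChange ℚ_[p]).toAffine.Point, p • P = 0 → P = 0)) →
      P2OpenInputOnTreeAt W p)
    (hOff : ∀ (W : WeierstrassCurve ℚ) [W.IsElliptic] [W.IsGloballyMinimal] (p : ℕ) [Fact p.Prime],
      ¬ Ram W p → P2OpenInputOnTreeAt W p) :
    ∀ (W : WeierstrassCurve ℚ) [W.IsElliptic] [W.IsGloballyMinimal] (p : ℕ) [Fact p.Prime],
      P2OpenInputOnTreeAt W p := by
  refine openInputIMCBody_of_print_of_coreB_of_rest3_of_notRam_of_facts hVN h3 hF hWu (fun W _ _ p _ hram hw ↦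
    hrest W p hram fun hw' ↦ hw ?_) hOff
  obtain ⟨⟨q, hqF, hq2, hqp, hmq, hnsq, hvq⟩, htors⟩ := hw'
  refine ⟨⟨q, hqF, hq2, hqp, hmq, hnsq, fun hd ↦ hvq ?_⟩, htors⟩
  exact_mod_cast hd

/-- **The kernel theorem AT ONE PAIR, without the Jetchev–Skinner–Wan binder** (the form a per-pair consumer cites).
CONDITIONAL. [claim: Castella2018Erratum, status: under-review] -/
theorem openInputIMCBody_of_print_of_coreB_of_rest3_of_notRam_of_facts_at
    (hVN : castella2018Exceptional_bdpValueContinuity_trivialChar)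
    (h3 : ∀ (W : WeierstrassCurve ℚ) [W.IsElliptic] [W.IsGloballyMinimal] (p : ℕ) [Fact p.Prime],
      P2.IMCDivIntCoreFrameAtErratumDataB W p)
    (hF : GrossZagier1986_thm_I_7_3 ∧ rank_eq_analyticRank_of_analyticRank_le_one ∧
      Skinner2016.thmC_padicValRat_bsd_rank_zero ∧ exists_isNewformOf ∧
      CaiShuTian2014.thm11_trivialChar ∧ friedbergHoffstein_exists_twist_ne_zero_ramifiedAt ∧
      mazur_not_dvd_maninConstant_of_odd ∧
      (∀ (N : ℕ) [NeZero N] (W : WeierstrassCurve ℚ) (K : Type) [Field K] [NumberField K],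
        gross_zagier N W K) ∧
      (∀ (N : ℕ) [NeZero N] (W : WeierstrassCurve ℚ) (K : Type) [Field K] [NumberField K],
        kolyvagin N W K) ∧
      (∀ (N : ℕ) [NeZero N] (W : WeierstrassCurve ℚ) (K : Type) [Field K] [NumberField K],
        Kolyvagin1990_padicValNat_card_sha_le N W K) ∧
      HoffsteinLuo1997_exists_twist_L_one_ne_zero ∧
      (∀ (K : Type) [Field K] [NumberField K], poitouTate_sum_localTatePairing_eq_zero K) ∧
      (∀ (K : Type) [Field K] [NumberField K], poitouTate_selmerStructure_duality K) ∧
      (∀ (K : Type) [Field K] [NumberField K], poitouTate_sha_tateDual K) ∧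
      (∀ (K : Type) [Field K] [NumberField K] (v : HeightOneSpectrum (𝓞 K)),
        localEulerPoincareCharacteristic (v.adicCompletion K)) ∧
      fieldCdLE_two_of_numberField)
    (hWu : sha_dvd_analyticSha)
    (hrest : ∀ (W : WeierstrassCurve ℚ) [W.IsElliptic] [W.IsGloballyMinimal] (p : ℕ) [Fact p.Prime],
      Ram W p →
      ¬ ((∃ (q : ℕ) (_ : Fact q.Prime), q ≠ 2 ∧ q ≠ p ∧ Mult W q ∧
            ¬ W.HasSplitMultiplicativeReductionAtPrime q ∧
            ¬ p ∣ padicValInt q W.minimalDiscriminantInt) ∧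
          (∀ P : (W.baseChange ℚ_[p]).toAffine.Point, p • P = 0 → P = 0)) →
      P2OpenInputOnTreeAt W p)
    (hOff : ∀ (W : WeierstrassCurve ℚ) [W.IsElliptic] [W.IsGloballyMinimal] (p : ℕ) [Fact p.Prime],
      ¬ Ram W p → P2OpenInputOnTreeAt W p)
    (W : WeierstrassCurve ℚ) [W.IsElliptic] [W.IsGloballyMinimal] (p : ℕ) [Fact p.Prime] :
    P2OpenInputOnTreeAt W p :=
  openInputIMCBody_of_print_of_coreB_of_rest3_of_notRam_of_facts hVN h3 hF hWu hrest hOff W p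

end Summit.BirchSwinnertonDyer.BirchSwinnertonDyer.Theorems.KernelFromPrintB

end
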